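import Summits.QuantumFields.YangMills.Theorems.BalabanUVNodesN20BlockCaricatureDiscrepancyToy

/-!
# BalabanUVNodes ∕ N20·N19′·N21 — WINDOW KEY vs FULL KEY ON THE CARICATURE (FILE M of the caricature series): a class key resolving a BOUNDED number of blocks passes stub 2's face
# triple as soon as the per-block two-run discrepancy is summable (first-order geometric contraction suffices), whereas a key whose expected number of large-field blocks DIVERGES
# (first-level saturation) fails it under ANY relative-discrepancy floor — in kernel form, from MY FILE K's closed form and FILE L's relative-precision criterion

Cell `pub-ymgap` (HUMAN RULING D-0062 Track A; work-bound push D-0149, director-ym №197), width seat `pub-ymgap-dag-n20-w1` (gen 6) on node N20 = NE7b; key item K3⁸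
`SpineGivenEndpointR13SepCoPHV` = stmt-QuantumFields-27366 (dag-lead KEY MAP v2, INBOX l.35754: `--kind proof --supports 27366 --as helper`; lineage key K3⁷ stmt-QuantumFields-20544 aside);
COUNT-NEUTRAL.  Bus: CLAIM-17 ∕ INTENT-22 (this seat's LANDED-21 line).  THEOREMS ONLY: no `def`, no `instance`, no `notation`, no `sorry`; imports MY FILE L `…N20BlockCaricatureDiscrepancyToy`
(p626122) only.

WHY.  The plan booked «K3 v6 = window key» (`kr := wkey`, plan g83 (D)) on located words; CRIT-1 priced `window-key-core` ED.4 SURVIVES.  On the independent-block caricature the closed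
form (FILE K) makes the comparison between the two keys a pair of three-line theorems: (§1) if the key resolves boundedly many blocks (`n_K ≤ N` — a fixed-width window of COARSE
birth scales), the criterion term is `≤ n_K|q_K − p_K| ≤ N·|q_K − p_K|`, so ANY summable per-block discrepancy — e.g. `|q_K − p_K| ≤ ρθ^K` with `θ < 1`, the shape a first-order
convergent-renormalisation letter gives — yields the dials; (§2) if the key resolves a DIVERGING expected number `n_K p_K → ∞` of large-field blocks (the FULL (2.18) key: every UV birth
scale keyed; MY policy wall p597932 and toy p605682 show `n_K p_K → ∞` for Bałaban's activity) and the two runs' per-block large-field probabilities keep any fixed RELATIVE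
discrepancy `ε_K ≥ ε₀ > 0` (run B is one RG step older at every UV block), then NO dials exist — the count laws separate.  Between the two sits FILE L's threshold (`ε_K = ρθ^K` with
`n_K = m^K`: dials ⟺ `mθ² < 1`).
* §1 [folklore ∕ bookkeeping] ★★★ `exists_hybridNE7_caricature_of_summable_meanShift` (ANY `n_K`: `Σ n_K|q_K − p_K| < ∞` ⇒ dials) · ★★ `exists_hybridNE7_caricature_of_boundedBlocks_of_geometric`
  (`n_K ≤ N`, `|q_K − p_K| ≤ ρθ^K`, `θ < 1` ⇒ dials).
* §2 [folklore ∕ bookkeeping] ★★★ `not_exists_hybridNE7_caricature_of_relDiscrepancy_floor` (`p_K ∈ (0,½]`, `q_K = p_K(1+ε_K)`, `ε₀ ≤ ε_K ≤ 1`, bulk ∀K, `n_K p_K → ∞` ⇒ NO dials) ·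
  `fullKey_hypotheses_inhabited` (A6: `n_K = 4^{K+2}`, `p = ¼`, `ε = ½`).

HONEST FRAMING.  [folklore] real analysis ∕ [bookkeeping] on a CARICATURE (independent level-1 blocks, product Bernoulli class weights — the card's simplification) with MODEL discrepancies
chosen by this seat; «window» and «full key» name the two caricature regimes, NOT dag-n20-d's key readings of record; NOTHING read at the record (which regime the record's keys realise,
and the two-run discrepancy there, are UNDECIDED — the unprinted (YG)∕(V-b) letter); proves NO estimate of Bałaban's; refutes NO registered stub (the caricature is not the stub); nothing of
Bałaban's asserted or instantiated.  NE7 ∕ NE7b ∕ NE7c NOT PRINTED for `d = 4`, NOT proved; N19 ∕ N20 ∕ N21 NOT discharged; K3⁸ (27366, v6 b4e55110ab73e679) ∕ aside K3⁷ OPEN, no stub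
claimed; counts unmoved (typed 28∕28 · discharged 5∕27); no count claim.  One finite `𝕋⁴` programme at fixed `ε`, Bałaban AS PRINTED; the YM mass gap (Clay) is NOT proved by any of
this — R4 closes the conditional finite-𝕋⁴ rung `BalabanLadder.UV` only; NOT ℝ⁴, NOT OS.  No decl carries a cite tag.
-/

set_option autoImplicit false

noncomputable section

open Finset Filter Topology
open Literature.MathematicalPhysics.QuantumFieldTheory.Balaban1983to89.T4MatchingAssembly (HybridNE7)
open Summit.QuantumFields.YangMills.BalabanUVNodes.N20BlockCaricatureClosedForm
open Summit.QuantumFields.YangMills.BalabanUVNodes.N20BlockCaricatureDiscrepancyToy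

namespace Summit.QuantumFields.YangMills.BalabanUVNodes.N20BlockCaricatureWindowVsFullKey

variable (n : ℕ → ℕ) (p q ε : ℕ → ℝ)

/-! ## §1 WINDOW-type caricature: a summable expected count shift always suffices [folklore ∕ bookkeeping] -/

/-- ★★★ **A SUMMABLE MEAN COUNT SHIFT ALWAYS SUFFICES** [folklore ∕ bookkeeping]: for `p_K ∈ (0,1)`, `q_K ∈ [0,1]` and ANY block numbers `n_K`, `Σ_K n_K·|q_K − p_K| < ∞` ⇒ SOME
`(Bad, W, shA, shB, Wsh, δ)` give `HybridNE7` on the caricature carriers (the closed-form term is `≤ Δ_K = n_K|q_K − p_K|`).  In particular a class key resolving a BOUNDED number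
`n_K ≤ N` of blocks (a fixed-width WINDOW of coarse scales) passes as soon as the per-block two-run discrepancy is summable — first-order geometric contraction is enough. -/
theorem exists_hybridNE7_caricature_of_summable_meanShift (hp : ∀ K, 0 < p K ∧ p K < 1) (hq : ∀ K, 0 ≤ q K ∧ q K ≤ 1)
    (hsum : Summable fun K => (n K : ℝ) * |q K - p K|) {l₀ : ℝ} (hl₀ : 0 ≤ l₀) (vol : ℝ) :
    ∃ (Bad : ℕ → ℝ → Finset (Finset ℕ)) (W : ℕ → ℝ) (shA shB : ℕ → ℝ → Finset ℕ → ℝ) (Wsh δ : ℕ → ℝ),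
      HybridNE7 l₀ vol (fun K => (Finset.range (n K)).powerset) (fun K _ S => p K ^ S.card * (1 - p K) ^ (n K - S.card))
        (fun K _ S => q K ^ S.card * (1 - q K) ^ (n K - S.card)) Bad W shA shB Wsh δ := by
  rw [exists_hybridNE7_caricature_iff_summable_closedForm n p q hp hq hl₀ vol]
  refine Summable.of_nonneg_of_le (fun K => le_min zero_le_one (by positivity)) (fun K => ?_) hsum
  have hΔ : 0 ≤ (n K : ℝ) * |q K - p K| := by positivity
  have hM : 1 ≤ max 1 (Real.sqrt (n K * max (p K * (1 - p K)) (q K * (1 - q K)))) := le_max_left _ _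
  exact (min_le_right _ _).trans (div_le_self hΔ hM)

/-- ★★ **THE BOUNDED-WINDOW CARICATURE PASSES AT FIRST ORDER** [folklore ∕ bookkeeping]: `n_K ≤ N` blocks, rates `p_K ∈ (0,1)`, `q_K ∈ [0,1]` with `|q_K − p_K| ≤ ρ·θ^K` (`0 ≤ θ < 1`)
⇒ the dials exist (`Σ N·ρ·θ^K < ∞`). -/
theorem exists_hybridNE7_caricature_of_boundedBlocks_of_geometric (hp : ∀ K, 0 < p K ∧ p K < 1) (hq : ∀ K, 0 ≤ q K ∧ q K ≤ 1)
    {N : ℕ} (hN : ∀ K, n K ≤ N) {ρ θ : ℝ} (hθ0 : 0 ≤ θ) (hθ1 : θ < 1) (hdisc : ∀ K, |q K - p K| ≤ ρ * θ ^ K)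
    {l₀ : ℝ} (hl₀ : 0 ≤ l₀) (vol : ℝ) :
    ∃ (Bad : ℕ → ℝ → Finset (Finset ℕ)) (W : ℕ → ℝ) (shA shB : ℕ → ℝ → Finset ℕ → ℝ) (Wsh δ : ℕ → ℝ),
      HybridNE7 l₀ vol (fun K => (Finset.range (n K)).powerset) (fun K _ S => p K ^ S.card * (1 - p K) ^ (n K - S.card))
        (fun K _ S => q K ^ S.card * (1 - q K) ^ (n K - S.card)) Bad W shA shB Wsh δ := by
  refine exists_hybridNE7_caricature_of_summable_meanShift n p q hp hq ?_ hl₀ vol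
  refine Summable.of_nonneg_of_le (fun K => by positivity) (fun K => ?_) ((summable_geometric_of_lt_one hθ0 hθ1).mul_left ((N : ℝ) * ρ))
  have hnN : (n K : ℝ) ≤ N := by exact_mod_cast hN K
  calc (n K : ℝ) * |q K - p K| ≤ N * (ρ * θ ^ K) := mul_le_mul hnN (hdisc K) (abs_nonneg _) (Nat.cast_nonneg N)
    _ = N * ρ * θ ^ K := by ring

/-! ## §2 FULL-KEY-type caricature: a diverging expected count with a relative discrepancy floor separates the laws [folklore ∕ bookkeeping] -/

/-- ★★★ **DIVERGING EXPECTED LARGE-FIELD COUNT × A RELATIVE DISCREPANCY FLOOR ⇒ NO DIALS** [folklore ∕ bookkeeping]: rates `p_K ∈ (0,½]`, `q_K = p_K(1 + ε_K)` with a FLOOR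
`ε₀ ≤ ε_K ≤ 1` (`ε₀ > 0`: the two runs' per-block large-field probabilities keep a fixed relative discrepancy), bulk at every step and `n_K·p_K → ∞` (the expected number of keyed
large-field blocks diverges — first-level SATURATION, as MY policy wall p597932 ∕ toy p605682 exhibit for Bałaban's activity at the FULL key) ⇒ NO `(Bad, W, shA, shB, Wsh, δ)` gives
`HybridNE7` on the caricature carriers: the relative-precision term `min(1, √(n_K p_K)·ε_K)` is eventually `1`. -/
theorem not_exists_hybridNE7_caricature_of_relDiscrepancy_floor (hp : ∀ K, 0 < p K ∧ p K ≤ 1 / 2) {ε₀ : ℝ} (hε₀ : 0 < ε₀) (hε : ∀ K, ε₀ ≤ ε K ∧ ε K ≤ 1)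
    (hbulk : ∀ K, 1 ≤ (n K : ℝ) * max (p K * (1 - p K)) (p K * (1 + ε K) * (1 - p K * (1 + ε K))))
    (hdiv : Tendsto (fun K => (n K : ℝ) * p K) atTop atTop) {l₀ : ℝ} (hl₀ : 0 ≤ l₀) (vol : ℝ) :
    ¬ ∃ (Bad : ℕ → ℝ → Finset (Finset ℕ)) (W : ℕ → ℝ) (shA shB : ℕ → ℝ → Finset ℕ → ℝ) (Wsh δ : ℕ → ℝ),
      HybridNE7 l₀ vol (fun K => (Finset.range (n K)).powerset) (fun K _ S => p K ^ S.card * (1 - p K) ^ (n K - S.card))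
        (fun K _ S => (p K * (1 + ε K)) ^ S.card * (1 - p K * (1 + ε K)) ^ (n K - S.card)) Bad W shA shB Wsh δ := by
  rw [exists_hybridNE7_caricature_iff_summable_relPrecision_of_bulk n p ε hp (fun K => ⟨hε₀.le.trans (hε K).1, (hε K).2⟩) hbulk hl₀ vol]
  apply not_summable_of_eventually_eq_one
  -- `n_K p_K ≥ ε₀⁻²` eventually ⇒ `√(n_K p_K)·ε_K ≥ √(n_K p_K)·ε₀ ≥ 1`
  filter_upwards [hdiv.eventually_ge_atTop (ε₀⁻¹ ^ 2)] with K hK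
  have h1 : ε₀⁻¹ ≤ Real.sqrt (n K * p K) := by
    rw [show ε₀⁻¹ = Real.sqrt ((ε₀⁻¹) ^ 2) by rw [Real.sqrt_sq (by positivity)]]
    exact Real.sqrt_le_sqrt hK
  have h2 : 1 ≤ Real.sqrt (n K * p K) * ε K := by
    calc (1 : ℝ) = ε₀⁻¹ * ε₀ := by field_simp
      _ ≤ Real.sqrt (n K * p K) * ε K := mul_le_mul h1 (hε K).1 hε₀.le (Real.sqrt_nonneg _)
  exact min_eq_left h2

/-- (A6) §2's hypotheses are JOINTLY INHABITED: `n_K = 4^{K+2}`, `p_K = ¼`, `ε_K = ε₀ = ½` (`q_K = ⅜`): bulk at every step (`4^{K+2}·(3∕16) ≥ 3`) and `n_K p_K = 4^{K+1} → ∞`. [folklore] -/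
theorem fullKey_hypotheses_inhabited :
    (∀ K : ℕ, (0 : ℝ) < 1 / 4 ∧ (1 : ℝ) / 4 ≤ 1 / 2) ∧ (0 : ℝ) < 1 / 2 ∧ (∀ K : ℕ, (1 : ℝ) / 2 ≤ 1 / 2 ∧ (1 : ℝ) / 2 ≤ 1) ∧
      (∀ K : ℕ, 1 ≤ ((4 ^ (K + 2) : ℕ) : ℝ) * max (1 / 4 * (1 - 1 / 4)) (1 / 4 * (1 + 1 / 2) * (1 - 1 / 4 * (1 + 1 / 2)))) ∧
      Tendsto (fun K : ℕ => ((4 ^ (K + 2) : ℕ) : ℝ) * (1 / 4)) atTop atTop := by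
  refine ⟨fun _ => ⟨by norm_num, by norm_num⟩, by norm_num, fun _ => ⟨le_rfl, by norm_num⟩, fun K => ?_, ?_⟩
  · have h4 : (16 : ℝ) ≤ ((4 ^ (K + 2) : ℕ) : ℝ) := by
      have : 4 ^ 2 ≤ 4 ^ (K + 2) := Nat.pow_le_pow_right (by norm_num) (by omega)
      exact_mod_cast this
    have hmax : (3 : ℝ) / 16 ≤ max (1 / 4 * (1 - 1 / 4)) (1 / 4 * (1 + 1 / 2) * (1 - 1 / 4 * (1 + 1 / 2))) := le_max_of_le_left (by norm_num)
    have := mul_le_mul h4 hmax (by norm_num) (by positivity)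
    linarith
  · have h : (fun K : ℕ => ((4 ^ (K + 2) : ℕ) : ℝ) * (1 / 4)) = fun K : ℕ => (4 : ℝ) * (4 : ℝ) ^ K := by
      funext K; push_cast; ring
    rw [h]
    exact (tendsto_pow_atTop_atTop_of_one_lt (by norm_num)).const_mul_atTop (by norm_num)

end Summit.QuantumFields.YangMills.BalabanUVNodes.N20BlockCaricatureWindowVsFullKey

end
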